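import Mathlib.Tactic
import HarnessLib

/-!
# Kozma–Nitzan's Question 8 — UNI-C(U;y): the sharper kill scale Q3 and the kill-only leaf (gen 40)

Support file (`--supports stmt-CriticalPhenomena-4575`, closed crux; independent mathematics on Kozma–Nitzan's Question 8,
arXiv:2401.12397 §5.5 p. 36), prover `prim-ineq-gen-6` (gen 40).  No definitions, no named facts, no sorries; standard axioms.
Memo `run/shared/lean/prim/prim-ineq-gen-6/PROOF-UNIC-LC-G40.md`.

THEOREM C-Y (gen 39, …KnQuestion8UniCStructure.lean) reduced `UNI-C(U;y)(t)` to the per-vertex test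
`min(JB3_v, JB5_v, KB_v) ≤ ½`, and THEOREM L-AB closed the region-connected and joint-visible vertices with `fa_{v−1} ≤ 1`.
This file supplies the algebraic cores of THEOREM L-C (the kill-only leaf, `fa_{v−1} ≤ 1`):
* `kLC_emission_far` — LEMMA E♯: the emission bound of PROOF-SSC-U-G27 with the *far* budget `B^far_j = xΦS_{j+1}a_jγ_jm_{j+1}`
  in place of `B` (the correction term still only needs `H_{j−1} ≤ ¾B`);
* `kLC_q3_term`, `kLC_q3_pair` — LEMMA Q3: an emission bounded both by `c·R` (THEOREM UB) and by `E/4` (LEMMA E♯) has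
  `e² ≤ c·RE/4`, and two such emissions add under the square root (the kill scale `Q₊² ≤ c·Q3`, `Q3 ≈ Q2/4`);
* `kLC_post2_quarter`, `kLC_atheta` — the linear budget bound `POST₂γ_i ≤ (1−S)·aθ_i/4 ≤ (3/8)(1−S)` behind the enlarged region leaf
  `σ_v ≥ ¾(1−S)`;
* `kLC_c_quarter`, `kLC_Kpp` — `c ≤ (Φ−m)²/4` and the lower bound of the kill constant `K″ = (K₃ − (1−S)B/4)/Φ`;
* `kLC_core_depth` — the per-depth kill core behind the aggregate kill weight (A-defect before the depth pays, the NEG term is kept);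
* `kLC_x_bound`, `kLC_ualpha`, `kLC_assembly` — the remaining links of the scalarisation `KQ_v ≤ F(S,a,γ_i,x,α,σ)`.
The scalar inequality `F ≤ ½` itself is an exact-rational box certificate (lab-g40/g40/b01_boxC.py, 80 cells; `F ≤ 0.27` with 430 cells).
Exact link checks: lab-g40/g40/l01_Q3.py, l03_leafC.py (0 failures).
[cite: KozmaNitzan2024, Question 8 (§5.5 p. 36)]
-/

namespace Summit.CriticalPhenomena.PercolationContinuityZ3.Theorems

namespace PocketCert

/-- **LEMMA E♯ (core).**  In LEMMA E the quarter trick produces the *far* budget `Bfar ≤ B`; the correction `(1−γ)(B − H)`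
(from `L̃_j ≥ a_j(1−γ_j)(Φπ − c − H_{j−1})`, `Φπ − c ≥ B`) absorbs the factor `1/γ` as soon as `H ≤ ¾B`, because
`a²S·Bfar/4 ≤ B/4 ≤ B − H`.  Hence `η_j ≤ ¼(1−s_{j+1})S_{j+1}a_j²(u″/p_j)·Bfar_j` with `Bfar_j = xΦS_{j+1}a_jγ_jm_{j+1}`.
[cite: KozmaNitzan2024, Question 8 (§5.5 p. 36)] -/
theorem kLC_emission_far (γ a2S B Bfar H : ℝ) (hγ1 : γ ≤ 1) (ha1 : a2S ≤ 1)
    (hBf0 : 0 ≤ Bfar) (hBfB : Bfar ≤ B) (hH : H ≤ 3 / 4 * B) :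
    a2S / 4 * Bfar - (1 - γ) * (B - H) ≤ γ * (a2S / 4 * Bfar) := by
  have h1 : 0 ≤ 1 - γ := by linarith
  have h2 : a2S / 4 * Bfar ≤ B - H := by nlinarith
  have h3 : 0 ≤ (1 - γ) * ((B - H) - a2S / 4 * Bfar) := mul_nonneg h1 (by linarith)
  nlinarith

/-- **LEMMA Q3 (one depth).**  If an emission satisfies `e ≤ c·R` (THEOREM UB's law) and `e ≤ E/4` (LEMMA E♯), then
`e² ≤ c·(R·E/4)`.
[cite: KozmaNitzan2024, Question 8 (§5.5 p. 36)] -/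
theorem kLC_q3_term (e c R E : ℝ) (he : 0 ≤ e) (hc : 0 ≤ c) (hR : 0 ≤ R)
    (h1 : e ≤ c * R) (h2 : e ≤ E / 4) : e ^ 2 ≤ c * (R * E / 4) := by
  have hE : 0 ≤ E / 4 := le_trans he h2
  have : e * e ≤ (c * R) * (E / 4) := mul_le_mul h1 h2 he (by positivity)
  nlinarith

/-- **LEMMA Q3 (adding depths).**  If `e₁² ≤ c·X₁` and `e₂² ≤ c·X₂` with everything non-negative then
`(e₁ + e₂)² ≤ c·(√X₁ + √X₂)²`; iterating gives `Q₊² ≤ c·Q3`, `Q3 = ¼(Σ_j √(R_jE_j))²`.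
[cite: KozmaNitzan2024, Question 8 (§5.5 p. 36)] -/
theorem kLC_q3_pair (e₁ e₂ c X₁ X₂ : ℝ) (he₁ : 0 ≤ e₁) (he₂ : 0 ≤ e₂) (hc : 0 ≤ c)
    (h1 : e₁ ^ 2 ≤ c * X₁) (h2 : e₂ ^ 2 ≤ c * X₂) :
    (e₁ + e₂) ^ 2 ≤ c * (Real.sqrt X₁ + Real.sqrt X₂) ^ 2 := by
  have s1 : Real.sqrt (e₁ ^ 2) = e₁ := Real.sqrt_sq he₁
  have s2 : Real.sqrt (e₂ ^ 2) = e₂ := Real.sqrt_sq he₂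
  have b1 : e₁ ≤ Real.sqrt c * Real.sqrt X₁ := by
    rw [← s1, ← Real.sqrt_mul hc]; exact Real.sqrt_le_sqrt h1
  have b2 : e₂ ≤ Real.sqrt c * Real.sqrt X₂ := by
    rw [← s2, ← Real.sqrt_mul hc]; exact Real.sqrt_le_sqrt h2
  have hs : e₁ + e₂ ≤ Real.sqrt c * (Real.sqrt X₁ + Real.sqrt X₂) := by nlinarith
  have hpos : 0 ≤ Real.sqrt c * (Real.sqrt X₁ + Real.sqrt X₂) :=
    mul_nonneg (Real.sqrt_nonneg c) (add_nonneg (Real.sqrt_nonneg X₁) (Real.sqrt_nonneg X₂))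
  have hsq : (e₁ + e₂) ^ 2 ≤ (Real.sqrt c * (Real.sqrt X₁ + Real.sqrt X₂)) ^ 2 :=
    pow_le_pow_left₀ (add_nonneg he₁ he₂) hs 2
  have hcc : Real.sqrt c ^ 2 = c := Real.sq_sqrt hc
  calc (e₁ + e₂) ^ 2 ≤ (Real.sqrt c * (Real.sqrt X₁ + Real.sqrt X₂)) ^ 2 := hsq
    _ = Real.sqrt c ^ 2 * (Real.sqrt X₁ + Real.sqrt X₂) ^ 2 := by ring
    _ = c * (Real.sqrt X₁ + Real.sqrt X₂) ^ 2 := by rw [hcc]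

/-- **Linear budget bound, quarter step.**  With `h = √(1 − θ(1−x))` the budget constant is `g(x,θ) = xθ²/(1+h)²`; for
`½ ≤ x ≤ 1` and `θ ≤ 3/2` one has `4x ≤ (1+h)²`, i.e. `g(x,θ) ≤ θ²/4` and `POST₂γ_i ≤ (1−S)·xθ_i·a/(1+h)² ≤ (1−S)·aθ_i/4`.
[cite: KozmaNitzan2024, Question 8 (§5.5 p. 36)] -/
theorem kLC_post2_quarter (x θ h : ℝ) (hx0 : 1 / 2 ≤ x) (hx1 : x ≤ 1) (hθ0 : 0 ≤ θ) (hθ1 : θ ≤ 3 / 2)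
    (hh0 : 0 ≤ h) (hh : h ^ 2 = 1 - θ * (1 - x)) : 4 * x ≤ (1 + h) ^ 2 := by
  -- with y = 1 − x ∈ [0, ½] and w = 2 − (4−θ)y:  (1+h)² − 4x = 2h − w + (h² − 1 + θy) = 2h − w, and 4h² − w² ≥ 0.
  have hy0 : 0 ≤ 1 - x := by linarith
  have hy1 : 1 - x ≤ 1 / 2 := by linarith
  have key : (2 - (4 - θ) * (1 - x)) ^ 2 ≤ 4 * h ^ 2 := by
    rw [hh]
    nlinarith [mul_nonneg hy0 hθ0, mul_nonneg hy0 (by linarith : (0:ℝ) ≤ 3 / 2 - θ),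
               mul_nonneg (mul_nonneg hy0 hy0) hθ0]
  rcases le_or_gt (2 - (4 - θ) * (1 - x)) 0 with hw | hw
  · nlinarith
  · have : 2 - (4 - θ) * (1 - x) ≤ 2 * h := by
      nlinarith [sq_nonneg (2 * h - (2 - (4 - θ) * (1 - x))), sq_nonneg (2 * h + (2 - (4 - θ) * (1 - x)))]
    nlinarith

/-- **Linear budget bound, θ step.**  At the last positive depth `γ_i > 1 − a²S/3` (positivity, (J4)); hence
`a·θ_i = a²/γ_i ≤ 3/2`, and with `kLC_post2_quarter`: `POST₂γ_i ≤ (3/8)(1−S)` — the region leaf extends to `σ_v ≥ ¾(1−S)`.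
[cite: KozmaNitzan2024, Question 8 (§5.5 p. 36)] -/
theorem kLC_atheta (a γ S : ℝ) (ha0 : 0 ≤ a) (ha1 : a ≤ 1) (hS1 : S ≤ 1) (hγ : 1 - a ^ 2 * S / 3 ≤ γ) :
    a ^ 2 ≤ 3 / 2 * γ := by
  have : a ^ 2 ≤ 1 := by nlinarith
  nlinarith

/-- **Out-defect bound.**  `c = D·ϖ/Φ ≤ D·u` (since `ϖ = Φu − m(1−Φ) ≤ Φu`) and `D + u ≤ Φ − m`, so `c ≤ (Φ−m)²/4`.
[cite: KozmaNitzan2024, Question 8 (§5.5 p. 36)] -/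
theorem kLC_c_quarter (c D u Φ m : ℝ) (hD : 0 ≤ D) (hu : 0 ≤ u) (hsum : D + u ≤ Φ - m) (hc : c ≤ D * u) :
    c ≤ (Φ - m) ^ 2 / 4 := by
  nlinarith [sq_nonneg (D - u)]

/-- **The kill constant.**  For every depth `l ≥ k₁` the positive emission before it is `H_{l−1} = H_i ≤ (1−S)B/4`
(PROPOSITION H at the last positive depth), so the main kill constant is `K″ := (K₃ − (1−S)B/4)/Φ` with `K₃ = Φ + m − c`,
`B = Φ²m/(Φ+m)`.  From `c ≤ (Φ−m)²/4` and `Φ ≤ 1`:  `Φ·K″ ≥ (Φ+m) − (Φ−m)²/(4Φ) − (1−S)Φ²m/(4(Φ+m))`, i.e. with `x = Φ/(Φ+m)`: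
`K″ ≥ 1/x − (2x−1)²/(4x²) − (1−S)Φ(1−x)/4`.
[cite: KozmaNitzan2024, Question 8 (§5.5 p. 36)] -/
theorem kLC_Kpp (Φ m c S : ℝ) (hΦ0 : 0 < Φ) (hΦ1 : Φ ≤ 1) (hc : c ≤ (Φ - m) ^ 2 / 4) :
    (Φ + m) - (Φ - m) ^ 2 / (4 * Φ) - (1 - S) * (Φ ^ 2 * m / (Φ + m)) / 4
      ≤ Φ + m - c - (1 - S) * (Φ ^ 2 * m / (Φ + m)) / 4 := by
  have h1 : (Φ - m) ^ 2 / 4 ≤ (Φ - m) ^ 2 / (4 * Φ) := by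
    rw [div_le_div_iff₀ (by norm_num : (0:ℝ) < 4) (by positivity)]
    nlinarith [sq_nonneg (Φ - m)]
  linarith

/-- **Per-depth kill core.**  At a depth `l` behind the first A-defect, with kill weight `W = (1−s_{l+1})S_[l+2,v] ≥ 0`,
A-survival `A = A_[l+1,v]` (so `A·a_l = a_v`), `1 − a_l ≥ a_l·fa_l` and the kill coefficient
`κ3_l = (1−a_l)K + a_lK₄ − a_l²ΦS_{l+1}u_{l+1}` (`K = K₃ − (1−S)B/4 ≥ 0`):
`W·A·κ3_l ≥ K·a_v·(W·fa_l) − Φ·a_v·(W·a_lS_{l+1}u_{l+1})`.  Summing over `l` and using `Σ_l W_l fa_l = fa_{v−1}(1 − S̄^A_v)`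
gives the aggregate kill weight `Σ_l W_lA_[l+1,v]κ3_l ≥ a_v[fa(1−S̄)K − Φ·T_v]`.
[cite: KozmaNitzan2024, Question 8 (§5.5 p. 36)] -/
theorem kLC_core_depth (W A al av fa K K4 Φ Su : ℝ) (hW : 0 ≤ W) (hA : 0 ≤ A) (hal : 0 ≤ al) (hK : 0 ≤ K) (hK4 : 0 ≤ K4)
    (hAa : A * al = av) (hfa : al * fa ≤ 1 - al) :
    K * av * (W * fa) - Φ * av * (W * (al * Su)) ≤ W * A * ((1 - al) * K + al * K4 - al ^ 2 * Φ * Su) := by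
  have h1 : W * A * (al * fa) * K ≤ W * A * (1 - al) * K := by
    have := mul_le_mul_of_nonneg_left hfa (mul_nonneg hW hA)
    nlinarith [mul_nonneg (mul_nonneg hW hA) hK]
  have h2 : 0 ≤ W * A * al * K4 := by positivity
  have e1 : K * av * (W * fa) = W * A * (al * fa) * K := by rw [← hAa]; ring
  have e2 : Φ * av * (W * (al * Su)) = W * A * (al ^ 2 * Φ * Su) := by rw [← hAa]; ring
  nlinarith

/-- **The x-bound.**  `m ≥ a·γ_i·(1−S)·Φ` (the near part of the doubly-good mass: `p_k ≥ Φ`, `γ_k ≥ γ_i` for `k ≤ i`,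
`Σ_{k<k₁} ω_k = 1 − S`), hence `1/x = (Φ+m)/Φ ≥ 1 + aγ_i(1−S)`.
[cite: KozmaNitzan2024, Question 8 (§5.5 p. 36)] -/
theorem kLC_x_bound (Φ m a γ S : ℝ) (hΦ : 0 < Φ) (hm : a * γ * (1 - S) * Φ ≤ m) :
    1 + a * γ * (1 - S) ≤ (Φ + m) / Φ := by
  rw [le_div_iff₀ hΦ]
  nlinarith

/-- **A-defect channel in units of α.**  `u_{k₁} ≤ α + σ(1−α)ǔ_v` ((U), gen 38) and `ǔ_v ≤ (29/50)α` on the kill leaf give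
`u_{k₁} ≤ α·(1 + (29/50)σ(1−α))`.
[cite: KozmaNitzan2024, Question 8 (§5.5 p. 36)] -/
theorem kLC_ualpha (u α σ uc : ℝ) (hσ : 0 ≤ σ) (hα1 : α ≤ 1) (hu : u ≤ α + σ * (1 - α) * uc)
    (huc : uc ≤ 29 / 50 * α) : u ≤ α * (1 + 29 / 50 * σ * (1 - α)) := by
  have : σ * (1 - α) * uc ≤ σ * (1 - α) * (29 / 50 * α) :=
    mul_le_mul_of_nonneg_left huc (mul_nonneg hσ (by linarith))
  nlinarith

/-- **Assembly of the kill member.**  If the kill weight dominates the aggregate form, `KW ≥ D > 0`, the need/supply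
ratio satisfies `r/Y ≤ γ` (Λ ≤ 1 for `fa ≤ 1`) and the kill scale satisfies `Q3 ≤ Q3box`, then
`KQ = (r/Y)·Q3/KW ≤ γ·Q3box/D`.
[cite: KozmaNitzan2024, Question 8 (§5.5 p. 36)] -/
theorem kLC_assembly (rY γ Q3 Q3box KW D : ℝ) (hrY0 : 0 ≤ rY) (hrY : rY ≤ γ) (hQ30 : 0 ≤ Q3) (hQ3 : Q3 ≤ Q3box)
    (hD : 0 < D) (hKW : D ≤ KW) : rY * Q3 / KW ≤ γ * Q3box / D := by
  have hKW0 : 0 < KW := lt_of_lt_of_le hD hKW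
  rw [div_le_div_iff₀ hKW0 hD]
  have h1 : rY * Q3 ≤ γ * Q3box := mul_le_mul hrY hQ3 hQ30 (le_trans hrY0 hrY)
  have h2 : 0 ≤ γ * Q3box := le_trans (mul_nonneg hrY0 hQ30) h1
  calc rY * Q3 * D ≤ γ * Q3box * D := mul_le_mul_of_nonneg_right h1 hD.le
    _ ≤ γ * Q3box * KW := mul_le_mul_of_nonneg_left hKW h2

end PocketCert

end Summit.CriticalPhenomena.PercolationContinuityZ3.Theorems
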